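import Summits.Ventures.GridStability.Models.StructurePreservingDAEEnergy
import Summits.Ventures.GridStability.Models.Loads
import HarnessLib

/-!
# GridStability/Models/StructurePreservingDAEConservation — «the system is conservative»: the printed
# structure-preserving energy with voltage-dependent reactive loads is a FIRST INTEGRAL of the DAE
# model MV-4 (Padiyar (3.40)), kernel-checked along every smooth solution

LADDER-GRIDFUSION G3 (model register), seat gridfusion-model-2 (g8); `plan/MODEL-VALIDITY.md` row
**MV-4**. Continues `StructurePreservingDAEEnergy.lean` (the energy `Params.energy` = Padiyar (3.32) /
Sauer–Pai (9.73)–(9.77) on the tree's DAE record [cite: SauerPai1998, §7.9.2 eqs (7.191)–(7.196)],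
its gradient form and the algebraic core `energyRate_eq_gradientForm`). Here the calculus: along a
solution `(δ, ω, V, θ)` of the DAE (`IsSolution`: (7.193)–(7.196) at every bus and instant) whose
ALGEBRAIC variables `V_k, θ_k` are differentiable in time with `V_k(t) > 0` — the printed
well-posedness assumption «the voltages at the load buses can be solved in a continuous manner …
the system trajectories are smooth» [cite: Padiyar2013, §3.4.4 Comment 1], carried as an explicit
HYPOTHESIS (MODEL-VALIDITY MV-4 (c): index-1 solvability is not proved here) — with CONSTANT
active-power loads and reactive characteristics continuous on `(0, ∞)`, the chain rule gives `dW/dt =` gradient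
form at the velocity `= 0` [cite: Padiyar2013, §3.4.4 eqs (3.38)–(3.40)]: `W` is conserved. No
damping is printed in (7.194); with a damping torque the same computation gives `−ΣDᵢ(ωᵢ − ω_s)²`.
## Contents (PROVED; MODELLED column only — MODEL MV-4; no certificate, no grid sentence)
`hasDerivAt_energy` (`dW/dt = 0`), `energy_eq_of_isSolution` (`W(t) = W(0)`);
`isOperatingPoint_of_gradientForm_eq_zero` (converse of the critical-point statement: rest states of
MV-4 = critical points of the printed energy on `{ω ≡ ω_s}`); admissibility of the printed static
reactive-load rows of `Models/Loads.lean` (`continuousOn_zip`, `continuousOn_exponential`,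
`continuousOn_constantImpedance`, `continuousOn_constantCurrent`, `continuousOn_constantPower`).
-/

noncomputable section

open Finset Real Set MeasureTheory intervalIntegral

namespace Summit.Ventures.GridStability.Models.StructurePreservingDAE.Params

variable {m n : ℕ}

/-- **The differential of the energy along ANY smooth path** (chain rule + FTC): for functions
`δ, ω, V, θ` of time with derivatives `a, α, u, φ` at `t`, positive voltages `V_k(t) > 0`,
reference voltages `V*_k > 0`, CONSTANT active loads and reactive characteristics continuous on
`(0, ∞)`, the function `s ↦ W(δ(s), ω(s), V(s), θ(s))` has derivative `gradientForm` at the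
velocity — no DAE equation is used here. [cite: Padiyar2013, §3.4.4 eqs (3.33)–(3.37)] -/
theorem hasDerivAt_energy_path {p : Params m n} (hB : ∀ k l, p.B k l = p.B l k)
    {δ ω : ℝ → Fin m → ℝ} {V θ : ℝ → Fin n → ℝ} {t : ℝ} {a α : Fin m → ℝ} {u φ : Fin n → ℝ}
    (hδ' : ∀ i, HasDerivAt (fun s => δ s i) (a i) t) (hω' : ∀ i, HasDerivAt (fun s => ω s i) (α i) t)
    (hV' : ∀ k, HasDerivAt (fun s => V s k) (u k) t) (hθ' : ∀ k, HasDerivAt (fun s => θ s k) (φ k) t)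
    (hVpos : ∀ k, 0 < V t k) {Vs : Fin n → ℝ} (hVs : ∀ k, 0 < Vs k)
    (hPL : ∀ k v, p.PL k v = p.PL k (Vs k)) (hQL : ∀ k, ContinuousOn (p.QL k) (Ioi 0)) :
    HasDerivAt (fun s => p.energy Vs (δ s) (ω s) (V s) (θ s))
      (p.gradientForm (δ t) (ω t) a α (V t) (θ t) u φ) t := by
  -- W₁
  have hK : HasDerivAt (fun s => p.kinetic (ω s)) (∑ i, p.M i * (ω t i - p.ωs) * α i) t := by
    have hsum : HasDerivAt (fun s => ∑ i, p.M i * (ω s i - p.ωs) ^ 2)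
        (∑ i, p.M i * (((2 : ℕ) : ℝ) * (ω t i - p.ωs) ^ (2 - 1) * α i)) t :=
      HasDerivAt.fun_sum fun i _ => (((hω' i).sub_const p.ωs).fun_pow 2).const_mul (p.M i)
    refine (hsum.const_mul (1 / 2 : ℝ)).congr_deriv ?_
    rw [Finset.mul_sum]
    refine Finset.sum_congr rfl fun i _ => ?_
    push_cast
    ring
  -- W₂₁
  have hT : HasDerivAt (fun s => ∑ i, p.TM i * δ s i) (∑ i, p.TM i * a i) t :=
    HasDerivAt.fun_sum fun i _ => (hδ' i).const_mul (p.TM i)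
  -- W₂₄
  have hU : HasDerivAt (fun s => p.machineEnergy (δ s) (V s) (θ s))
      (∑ i, (2 * V t (p.bus i) * u (p.bus i)
        - 2 * p.E i * (u (p.bus i) * Real.cos (δ t i - θ t (p.bus i))
          + V t (p.bus i) * (-Real.sin (δ t i - θ t (p.bus i)) * (a i - φ (p.bus i)))))
        / (2 * p.Xd' i)) t := by
    refine HasDerivAt.fun_sum fun i _ => ?_
    have h1 : HasDerivAt (fun s => V s (p.bus i) ^ 2) (2 * V t (p.bus i) * u (p.bus i)) t := by
      have := (hV' (p.bus i)).fun_pow 2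
      refine this.congr_deriv ?_
      push_cast
      ring
    have h2 : HasDerivAt (fun s => 2 * p.E i * V s (p.bus i) * Real.cos (δ s i - θ s (p.bus i)))
        (2 * p.E i * (u (p.bus i) * Real.cos (δ t i - θ t (p.bus i))
          + V t (p.bus i) * (-Real.sin (δ t i - θ t (p.bus i)) * (a i - φ (p.bus i))))) t := by
      have hc := ((hδ' i).fun_sub (hθ' (p.bus i))).cos
      have := ((hV' (p.bus i)).const_mul (2 * p.E i)).fun_mul hc
      refine this.congr_deriv ?_
      ring
    exact (h1.fun_sub h2).div_const (2 * p.Xd' i)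
  -- W₂₅
  have hN : HasDerivAt (fun s => p.networkEnergy (V s) (θ s))
      (-(1 / 2) * ∑ k, ∑ l, p.B k l * ((u k * V t l + V t k * u l) * Real.cos (θ t k - θ t l)
        + V t k * V t l * (-Real.sin (θ t k - θ t l) * (φ k - φ l)))) t := by
    refine HasDerivAt.const_mul (-(1 / 2) : ℝ) (HasDerivAt.fun_sum fun k _ => ?_)
    refine HasDerivAt.fun_sum fun l _ => ?_
    have hc := ((hθ' k).fun_sub (hθ' l)).cos
    have := (((hV' k).fun_mul (hV' l)).fun_mul hc).const_mul (p.B k l)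
    refine this.congr_deriv ?_
    ring
  -- W₂₂ (constant active loads)
  have hLP : HasDerivAt (fun s => ∑ k, p.PL k (V s k) * θ s k) (∑ k, p.PL k (V t k) * φ k) t := by
    refine HasDerivAt.fun_sum fun k _ => ?_
    have hconst : (fun s => p.PL k (V s k) * θ s k) = fun s => p.PL k (Vs k) * θ s k := by
      funext s; rw [hPL k (V s k)]
    rw [hconst, hPL k (V t k)]
    exact (hθ' k).const_mul _
  -- W₂₃
  have hLQ : HasDerivAt (fun s => ∑ k, ∫ v in Vs k..V s k, p.QL k v / v)
      (∑ k, p.QL k (V t k) / V t k * u k) t :=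
    HasDerivAt.fun_sum fun k _ => hasDerivAt_reactiveIntegral (hQL k) (hVs k) (hV' k) (hVpos k)
  have hW := ((((hK.fun_sub hT).fun_add hU).fun_add hN).fun_sub hLP).fun_sub hLQ
  rw [energyRate_eq_gradientForm hB (fun k => (hVpos k).ne')] at hW
  exact hW

/-- **The structure-preserving system with voltage-dependent reactive loads is CONSERVATIVE**
(Padiyar's «proof by direct verification», (3.33)–(3.40), kernel-checked on the tree's MV-4 record):
let `p` have a symmetric susceptance matrix, let `(δ, ω, V, θ)` solve the DAE (7.193)–(7.196)
(`p.IsSolution`), with the algebraic variables `V_k, θ_k` differentiable in time and `V_k(t) > 0`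
(the printed well-posedness assumption, Comment 1), CONSTANT active-power loads
(`P_Lk(v) = P_Lk(V*_k)` for all `v`) and reactive characteristics `Q_Lk` CONTINUOUS ON `(0, ∞)`
(every ZIP / exponential row of `Models/Loads.lean`), reference voltages `V*_k > 0`. Then
`t ↦ W(δ(t), ω(t), V(t), θ(t))` has derivative `0` at every `t`. MODEL MV-4; no damping is printed
in (7.194), so `W` is a first integral. Nothing here says a grid is stable.
[cite: Padiyar2013, §3.4.4 eqs (3.32)–(3.40), Comment 1, Comment 2; SauerPai1998, §9.8 eqs (9.70)–(9.77)] -/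
theorem hasDerivAt_energy {p : Params m n} (hB : ∀ k l, p.B k l = p.B l k)
    {δ ω : ℝ → Fin m → ℝ} {V θ : ℝ → Fin n → ℝ} (h : p.IsSolution δ ω V θ)
    (hVd : ∀ k, Differentiable ℝ fun t => V t k) (hθd : ∀ k, Differentiable ℝ fun t => θ t k)
    (hVpos : ∀ t k, 0 < V t k) {Vs : Fin n → ℝ} (hVs : ∀ k, 0 < Vs k)
    (hPL : ∀ k v, p.PL k v = p.PL k (Vs k)) (hQL : ∀ k, ContinuousOn (p.QL k) (Ioi 0)) (t : ℝ) :
    HasDerivAt (fun s => p.energy Vs (δ s) (ω s) (V s) (θ s)) 0 t := by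
  have hpath := hasDerivAt_energy_path hB (fun i => (h.differentiable_δ i t).hasDerivAt)
    (fun i => (h.differentiable_ω i t).hasDerivAt) (fun k => (hVd k t).hasDerivAt)
    (fun k => (hθd k t).hasDerivAt) (hVpos t) hVs hPL hQL
  have hangle : ∀ i, deriv (fun s => δ s i) t = ω t i - p.ωs := fun i => h.angle t i
  have hswing : ∀ i, p.M i * deriv (fun s => ω s i) t = p.TM i - p.PG (δ t) (V t) (θ t) i :=
    fun i => h.swing t i
  rw [gradientForm_eq_zero_of_equations hangle hswing (h.activeBalance t) (h.reactiveBalance t)]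
    at hpath
  exact hpath

/-- **Conservation of the structure-preserving energy along every DAE motion** (same hypotheses):
`W(t) = W(0)` for all `t ≥ 0` — «the total energy of the system is conserved»
[cite: Padiyar2013, §3.4.4 eq (3.40)]; [cite: SauerPai1998, §9.8]. MODEL MV-4. -/
theorem energy_eq_of_isSolution {p : Params m n} (hB : ∀ k l, p.B k l = p.B l k)
    {δ ω : ℝ → Fin m → ℝ} {V θ : ℝ → Fin n → ℝ} (h : p.IsSolution δ ω V θ)
    (hVd : ∀ k, Differentiable ℝ fun t => V t k) (hθd : ∀ k, Differentiable ℝ fun t => θ t k)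
    (hVpos : ∀ t k, 0 < V t k) {Vs : Fin n → ℝ} (hVs : ∀ k, 0 < Vs k)
    (hPL : ∀ k v, p.PL k v = p.PL k (Vs k)) (hQL : ∀ k, ContinuousOn (p.QL k) (Ioi 0)) (t : ℝ) :
    p.energy Vs (δ t) (ω t) (V t) (θ t) = p.energy Vs (δ 0) (ω 0) (V 0) (θ 0) := by
  have hd : ∀ s, HasDerivAt (fun s => p.energy Vs (δ s) (ω s) (V s) (θ s)) 0 s :=
    fun s => hasDerivAt_energy hB h hVd hθd hVpos hVs hPL hQL s
  exact is_const_of_deriv_eq_zero (fun s => (hd s).differentiableAt) (fun s => (hd s).deriv) t 0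

/-- **Conversely, critical points of the energy on `{ω ≡ ω_s}`-data are operating points**: if
at a state `(δ, ω, V, θ)` with `Mᵢ ≠ 0` and `V_k ≠ 0` the gradient form vanishes in EVERY direction,
then all speeds equal `ω_s` and `(δ, V, θ)` is an operating point of the DAE (swing balance and the
power-flow equations (7.195)–(7.196)) — with `gradientForm_eq_zero_of_isOperatingPoint`: the rest
states of MODEL MV-4 are EXACTLY the critical points of the printed energy (the structural fact behind
PEBS/BCU and the energy reading of «high- and low-power flow solutions»).
[cite: Padiyar2013, §3.4.4 eqs (3.33)–(3.37); SauerPai1998, §9.8] -/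
theorem isOperatingPoint_of_gradientForm_eq_zero {p : Params m n} (hM : ∀ i, p.M i ≠ 0)
    {δ ω : Fin m → ℝ} {V θ : Fin n → ℝ} (hV : ∀ k, V k ≠ 0)
    (h : ∀ (a α : Fin m → ℝ) (u φ : Fin n → ℝ), p.gradientForm δ ω a α V θ u φ = 0) :
    p.IsOperatingPoint δ V θ ∧ ∀ i, ω i = p.ωs := by
  -- probe the four coordinate directions with unit vectors
  have hω : ∀ i, ω i = p.ωs := fun i => by
    have h1 := h 0 (Pi.single i 1) 0 0
    simp only [gradientForm, Pi.zero_apply, zero_mul, zero_div, Finset.sum_const_zero, add_zero,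
      Pi.single_apply, mul_ite, mul_one, mul_zero, Finset.sum_ite_eq', Finset.mem_univ,
      if_true] at h1
    rcases mul_eq_zero.1 h1 with h2 | h2
    · exact absurd h2 (hM i)
    · linarith
  have hsw : ∀ i, p.TM i = p.PG δ V θ i := fun i => by
    have h1 := h (Pi.single i 1) 0 0 0
    simp only [gradientForm, Pi.zero_apply, zero_mul, mul_zero, zero_div, Finset.sum_const_zero,
      add_zero, zero_add, Pi.single_apply, ite_mul, one_mul, Finset.sum_ite_eq',
      Finset.mem_univ, if_true] at h1
    linarith
  have hP : ∀ k, p.PL k (V k) + p.PGbus δ V θ k = p.Pnet V θ k := fun k => by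
    have h1 := h 0 0 0 (Pi.single k 1)
    simp only [gradientForm, Pi.zero_apply, zero_mul, mul_zero, zero_div, Finset.sum_const_zero,
      add_zero, zero_add, Pi.single_apply, ite_mul, one_mul, Finset.sum_ite_eq',
      Finset.mem_univ, if_true] at h1
    linarith
  have hQ : ∀ k, p.QL k (V k) + p.QGbus δ V θ k = p.Qnet V θ k := fun k => by
    have h1 := h 0 0 (Pi.single k 1) 0
    simp only [gradientForm, Pi.zero_apply, zero_mul, mul_zero, Finset.sum_const_zero,
      add_zero, zero_add, Pi.single_apply, div_eq_mul_inv, ite_mul, one_mul,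
      Finset.sum_ite_eq', Finset.mem_univ, if_true] at h1
    rcases mul_eq_zero.1 h1 with h2 | h2
    · exact absurd (inv_eq_zero.1 h2) (hV k)
    · linarith
  exact ⟨⟨hsw, hP, hQ⟩, hω⟩

/-! ### With a damping torque the same energy is a Lyapunov function -/

/-- **Solutions of the structure-preserving DAE WITH A DAMPING TORQUE** `Dᵢ(ωᵢ − ω_s)` in the swing
equation — the damping of the internal-node model [cite: SauerPai1998, §9.2 eqs (9.15)–(9.18)]
transplanted onto the structure-preserving record (7.193)–(7.196) (a MODELLED VARIANT of MV-4: the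
printed (7.194) carries no damping term; every other equation unchanged). -/
structure IsDampedSolution (p : Params m n) (D : Fin m → ℝ) (δ ω : ℝ → Fin m → ℝ)
    (V θ : ℝ → Fin n → ℝ) : Prop where
  differentiable_δ : ∀ i, Differentiable ℝ fun t => δ t i
  differentiable_ω : ∀ i, Differentiable ℝ fun t => ω t i
  angle : ∀ t i, deriv (fun s => δ s i) t = ω t i - p.ωs
  swing : ∀ t i, p.M i * deriv (fun s => ω s i) t
    = p.TM i - p.PG (δ t) (V t) (θ t) i - D i * (ω t i - p.ωs)
  activeBalance : ∀ t k, p.PL k (V t k) + p.PGbus (δ t) (V t) (θ t) k = p.Pnet (V t) (θ t) k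
  reactiveBalance : ∀ t k, p.QL k (V t k) + p.QGbus (δ t) (V t) (θ t) k = p.Qnet (V t) (θ t) k

/-- With the damped swing equation the gradient form evaluates to `−Σ Dᵢ(ωᵢ − ω_s)²`.
[cite: Padiyar2013, §3.4.4 eqs (3.33)–(3.39); SauerPai1998, §9.2 eq (9.18)] -/
theorem gradientForm_eq_of_damped {p : Params m n} {D : Fin m → ℝ} {δ ω a α : Fin m → ℝ}
    {V θ u φ : Fin n → ℝ} (hangle : ∀ i, a i = ω i - p.ωs)
    (hswing : ∀ i, p.M i * α i = p.TM i - p.PG δ V θ i - D i * (ω i - p.ωs))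
    (hP : ∀ k, p.PL k (V k) + p.PGbus δ V θ k = p.Pnet V θ k)
    (hQ : ∀ k, p.QL k (V k) + p.QGbus δ V θ k = p.Qnet V θ k) :
    p.gradientForm δ ω a α V θ u φ = -∑ i, D i * (ω i - p.ωs) ^ 2 := by
  unfold gradientForm
  have h1 : ∑ i, p.M i * (ω i - p.ωs) * α i + ∑ i, a i * (p.PG δ V θ i - p.TM i)
      = -∑ i, D i * (ω i - p.ωs) ^ 2 := by
    rw [← Finset.sum_add_distrib, ← Finset.sum_neg_distrib]
    refine Finset.sum_congr rfl fun i _ => ?_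
    rw [hangle i]
    linear_combination (ω i - p.ωs) * hswing i
  have h2 : ∑ k, φ k * (p.Pnet V θ k - p.PGbus δ V θ k - p.PL k (V k)) = 0 :=
    Finset.sum_eq_zero fun k _ => by rw [← hP k]; ring
  have h3 : ∑ k, u k / V k * (p.Qnet V θ k - p.QGbus δ V θ k - p.QL k (V k)) = 0 :=
    Finset.sum_eq_zero fun k _ => by rw [← hQ k]; ring
  rw [h1, h2, h3]
  ring

/-- **With damping the printed energy is a Lyapunov function of MODEL MV-4 (damped variant)**:
along every solution of the damped DAE with differentiable algebraic variables, positive voltages,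
constant-P and `(0, ∞)`-continuous `Q(V)` loads, `dW/dt = −Σᵢ Dᵢ (ωᵢ − ω_s)²` — the MV-4
counterpart of the MV-3 statement `hasDerivAt_energy` of `StructurePreserving.lean`. No positivity,
level or region is claimed. [cite: Padiyar2013, §3.4.4 eqs (3.32)–(3.40); SauerPai1998, §9.2 eq (9.18), §9.8 eqs (9.73)–(9.77)] -/
theorem hasDerivAt_energy_damped {p : Params m n} (hB : ∀ k l, p.B k l = p.B l k) {D : Fin m → ℝ}
    {δ ω : ℝ → Fin m → ℝ} {V θ : ℝ → Fin n → ℝ} (h : p.IsDampedSolution D δ ω V θ)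
    (hVd : ∀ k, Differentiable ℝ fun t => V t k) (hθd : ∀ k, Differentiable ℝ fun t => θ t k)
    (hVpos : ∀ t k, 0 < V t k) {Vs : Fin n → ℝ} (hVs : ∀ k, 0 < Vs k)
    (hPL : ∀ k v, p.PL k v = p.PL k (Vs k)) (hQL : ∀ k, ContinuousOn (p.QL k) (Ioi 0)) (t : ℝ) :
    HasDerivAt (fun s => p.energy Vs (δ s) (ω s) (V s) (θ s))
      (-∑ i, D i * (ω t i - p.ωs) ^ 2) t := by
  have hpath := hasDerivAt_energy_path hB (fun i => (h.differentiable_δ i t).hasDerivAt)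
    (fun i => (h.differentiable_ω i t).hasDerivAt) (fun k => (hVd k t).hasDerivAt)
    (fun k => (hθd k t).hasDerivAt) (hVpos t) hVs hPL hQL
  have hangle : ∀ i, deriv (fun s => δ s i) t = ω t i - p.ωs := fun i => h.angle t i
  have hswing : ∀ i, p.M i * deriv (fun s => ω s i) t
      = p.TM i - p.PG (δ t) (V t) (θ t) i - D i * (ω t i - p.ωs) := fun i => h.swing t i
  rw [gradientForm_eq_of_damped hangle hswing (h.activeBalance t) (h.reactiveBalance t)] at hpath
  exact hpath

/-! ### The printed static reactive-load rows are admissible `Q_L` characteristics -/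

/-- The ZIP (polynomial) load row [cite: Kundur1994, §7.1.1 eq (7.2)] is continuous on `(0, ∞)`
(indeed everywhere): admissible as `Q_Lk` in `hasDerivAt_energy`. -/
theorem continuousOn_zip (P0 V0 p1 p2 p3 : ℝ) : ContinuousOn (Loads.zip P0 V0 p1 p2 p3) (Ioi 0) := by
  apply Continuous.continuousOn
  unfold Loads.zip
  fun_prop

/-- The exponential load row `Q₀ (V/V₀)^b` [cite: Kundur1994, §7.1.1 eq (7.1)] (`Real.rpow`) is
continuous on `(0, ∞)` for a positive nominal voltage `V₀`: admissible as `Q_Lk` in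
`hasDerivAt_energy` (this is why the hypothesis there is continuity on `(0, ∞)` only). -/
theorem continuousOn_exponential {P0 V0 : ℝ} (hV0 : 0 < V0) (a : ℝ) :
    ContinuousOn (Loads.exponential P0 V0 a) (Ioi 0) := by
  unfold Loads.exponential
  refine continuousOn_const.mul (ContinuousOn.rpow_const ?_ fun V hV => Or.inl ?_)
  · exact continuousOn_id.div_const V0
  · exact (div_pos hV hV0).ne'

/-- The constant-impedance row `Q₀(V/V₀)²` [cite: Kundur1994, §7.1.1 (exponent 2)] is admissible. -/
theorem continuousOn_constantImpedance (P0 V0 : ℝ) :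
    ContinuousOn (Loads.constantImpedance P0 V0) (Ioi 0) := by
  apply Continuous.continuousOn
  unfold Loads.constantImpedance
  fun_prop

/-- The constant-current row `Q₀(V/V₀)` [cite: Kundur1994, §7.1.1 (exponent 1)] is admissible. -/
theorem continuousOn_constantCurrent (P0 V0 : ℝ) :
    ContinuousOn (Loads.constantCurrent P0 V0) (Ioi 0) := by
  apply Continuous.continuousOn
  unfold Loads.constantCurrent
  fun_prop

/-- The constant-power row [cite: Kundur1994, §7.1.1 (exponent 0)] is admissible (constant). -/
theorem continuousOn_constantPower (P0 : ℝ) : ContinuousOn (Loads.constantPower P0) (Ioi 0) :=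
  continuousOn_const

end Summit.Ventures.GridStability.Models.StructurePreservingDAE.Params

end
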